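import Literature.Analysis.FluidPDE.SereginSlabLayerStrip
import Literature.Analysis.FluidPDE.JiaSverak2014SlabAprioriEstimate
import Literature.Analysis.FluidPDE.JiaSverak2014SlabPressureGauge
import Literature.Analysis.FluidPDE.JiaSverak2013AprioriEstimate
import Literature.Analysis.FluidPDE.LocalEnergyLimitBounds
import HarnessLib

/-!
# The almost-everywhere initial layer of local Leray solutions with `L³` data on slabs,
# uniformly in the length of the slab (Jia–Šverák 2013, Lemma 8 = Seregin 2012, (2.13))

Analysis/FluidPDE proof file (theorems only: no definition, no named fact, no `sorry`).

The accepted `NSSereginBlowupCore.lean` proves Seregin's `L³` blow-up criterion along Seregin's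
own architecture (G. Seregin, Comm. Math. Phys. 312 (2012) 833–845 = arXiv:1104.3615, §§2–4:
every object lives before the blow-up time) in its three tree forms
(`seregin_regular_of_liminf_L3`, `seregin_L3_blowup_mild` = Lemarié-Rieusset 2016, Thm. 15.5,
`seregin_L3_blowup` = ns.S08), **conditionally on one hypothesis `hSlab`**: the
almost-everywhere initial layer of local Leray solutions on slabs with `L³` data (Jia–Šverák
2013, Lemma 8 = Seregin 2012, (2.13); Lemarié-Rieusset 2016, Prop. 15.1, third item), with a
majorant `h = h_M` that is **uniform in the length of the slab**. This file proves `hSlab`: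

* `seregin_slabLayer` — for `M ≥ 0` there are `S₁ = ε₀ / max(1, M⁴) > 0` and `h = h_M → 0` at
  `0⁺` such that every local Leray solution `(u, p)` on `(0,T) × ℝ³` (unit viscosity) with weakly
  divergence-free datum `u₀ ∈ L³`, `‖u₀‖₃ ≤ M`, satisfies
  `‖u(t) − e^{tΔ}u₀‖_{L²(B(x₀,1))} ≤ h(t)` for a.e. `t < min(T, S₁)` and every `x₀`. Proof: on the
  short strip `(0, T')`, `T' = min(T, S₁) ≤ ε₀ min(1, M⁻⁴)`, Jia–Šverák's a priori estimate on
  slabs (`JiaSverak2014.apriori_unit_scale_slab`, Jia–Šverák 2014, Lemma 3.1 = 2013, Lemma 2)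
  bounds the unit-ball energies (a.e. in time) and the unit-cylinder dissipation of *every* weak
  spatial gradient in terms of `M` alone; a fixed finite cover (`Seregin2014Limit.exists_cover_const`)
  passes to the cylinders `(0,T') × B(x₀,3)`; the pressure is renormalised by Kang–Miura–Tsai's
  measurable gauge about `x₀` (`IsLocalLeraySolutionOn.exists_measurable_gauge`, `.sub_pressure`;
  Kang–Miura–Tsai 2021, Lemma 3.4 = Seregin 2012, (2.6)) and bounded on the window `(0, T')` by
  `JiaSverak2014.exists_window_pressure_bound_slab` (Seregin 2012, (2.7)–(2.8)), again in terms
  of `M` alone since `T' ≤ 1`; then `slab_ae_layer_strip` (`SereginSlabLayerStrip.lean`: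
  Jia–Šverák's Lemma 8 on short strips, majorant independent of the length) concludes — the
  layer does not see the gauge.

The discharges `seregin_regular_of_liminf_L3_holds`, `seregin_L3_blowup_mild_holds`,
`seregin_L3_blowup_holds`, `seregin_L3_blowup_energy_holds` are the one-line applications of the
conditional theorems of `NSSereginBlowupCore.lean` / `NSLerayHopfSereginAssembly.lean` to
`seregin_slabLayer` (sibling file `NSSereginL3BlowupHolds.lean`).

## References

* G. Seregin, *A certain necessary condition of potential blow up for Navier–Stokes equations*,
  Comm. Math. Phys. 312 (2012) 833–845 = arXiv:1104.3615, Thm. 1.1, §2 (2.6)–(2.13), §§3–4.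
  [`Seregin2012CMP`]
* P. G. Lemarié-Rieusset, *The Navier–Stokes Problem in the 21st Century* (CRC 2016),
  doi:10.1201/b19556, Thm. 15.5 (PDF p. 570, proof pp. 570–573), Prop. 15.1 (p. 559).
  [`LemarieRieusset2016`]
* H. Jia, V. Šverák, SIAM J. Math. Anal. 45 (2013) = arXiv:1201.1592, Lemma 2, Lemma 8;
  Invent. Math. 196 (2014) = arXiv:1204.0529, Lemma 3.1. [`JiaSverak2013`, `JiaSverak2014`]
* K. Kang, H. Miura, T.-P. Tsai, IMRN 2021 = arXiv:1812.10509, Lemmas 3.4–3.5.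
  [`KangMiuraTsai2020`]
-/

noncomputable section

open MeasureTheory TopologicalSpace Set Function Filter Metric
open _root_.Topology
open scoped ENNReal NNReal RealInnerProductSpace

namespace Literature.Analysis.FluidPDE

/-! ## The slab initial layer, uniformly in the length of the slab -/

set_option maxHeartbeats 1600000 in
/-- **The almost-everywhere initial layer of local Leray solutions with `L³` data on slabs,
uniformly in the length of the slab** (Jia–Šverák 2013, Lemma 8 = Seregin 2012, (2.13);
Lemarié-Rieusset 2016, Prop. 15.1, third item: "`‖u(t,.) − W_{νt} * u₀‖_{L²_uloc} ≤ η(t)`, where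
the function `η` depends only on `ν`, `T₀` and `M`"; here on the short strips
`t < min(T, S₁(M))`, which is all Seregin's line uses). For every `M ≥ 0` there are
`S₁ > 0` and `h : ℝ → ℝ≥0` with `h(t) → 0` as `t → 0⁺` such that for every local Leray solution
`(u, p)` on `(0, T) × ℝ³` with unit viscosity and weakly divergence-free datum `u₀ ∈ L³`,
`‖u₀‖₃ ≤ M`, and every `x₀`: `‖u(t) − e^{tΔ}u₀‖_{L²(B(x₀,1))} ≤ h(t)` for a.e. `t ∈ (0, min(T, S₁))`.
This is the hypothesis `hSlab` of `seregin_regular_of_liminf_L3_of_slabLayer`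
(`NSSereginBlowupCore.lean`). Proof in the module docstring (a priori inputs on `(0,T') × B(x₀,3)`
from `‖u₀‖₃ ≤ M` alone, then `slab_ae_layer_strip`).
[cite: JiaSverak2013, Lemma 8 and Lemma 2 (arXiv:1201.1592 pp. 3–4, 7)] [cite: Seregin2012CMP, §2 (2.6)–(2.13)] [cite: LemarieRieusset2016, Prop. 15.1 (p. 559)] [cite: KangMiuraTsai2020, Lemmas 3.4–3.5] -/
theorem seregin_slabLayer (M : ℝ≥0) :
    ∃ S₁ : ℝ, 0 < S₁ ∧ ∃ h : ℝ → ℝ≥0, Tendsto h (𝓝[>] 0) (𝓝 0) ∧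
      ∀ (T : ℝ) (u₀ : EuclideanSpace ℝ (Fin 3) → EuclideanSpace ℝ (Fin 3))
        (u : ℝ → EuclideanSpace ℝ (Fin 3) → EuclideanSpace ℝ (Fin 3))
        (p : ℝ → EuclideanSpace ℝ (Fin 3) → ℝ),
        MemLp u₀ 3 volume → IsWeaklyDivFree u₀ → eLpNorm u₀ 3 volume ≤ M →
        IsLocalLeraySolutionOn T 1 u₀ u p →
        ∀ x₀ : EuclideanSpace ℝ (Fin 3), ∀ᵐ t ∂(volume.restrict (Ioo 0 (min T S₁))),
          eLpNorm (u t - heatTest 1 u₀ t) 2 (volume.restrict (ball x₀ 1)) ≤ h t := by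
  -- ### the constants, all in terms of `M`
  obtain ⟨ε₀, hε₀, hε₀1, C, hapr⟩ := JiaSverak2014.apriori_unit_scale_slab
  obtain ⟨P₀, hP₀⟩ := JiaSverak2014.exists_window_pressure_bound_slab
  obtain ⟨N, hN₁, hN₂⟩ := Seregin2014Limit.exists_cover_const (3 : ℝ)
  set α : ℝ≥0 := M ^ 2 with hα
  set EM : ℝ≥0 := N * (2 * (C * α)) with hEM
  set AM : ℝ≥0 := N * (C * α) with hAM
  set PM : ℝ≥0 := P₀ * (2 * (C * α)) ^ (3 / 2 : ℝ) with hPM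
  obtain ⟨g, -, hg, hlayer⟩ := slab_ae_layer_strip M EM AM PM
  have hε₀r : (0 : ℝ) < ε₀ := NNReal.coe_pos.2 hε₀
  have hε₀1r : (ε₀ : ℝ) ≤ 1 := by exact_mod_cast hε₀1
  set S₁ : ℝ := (ε₀ : ℝ) / max 1 ((M : ℝ) ^ 4) with hS₁
  have hmax : (1 : ℝ) ≤ max 1 ((M : ℝ) ^ 4) := le_max_left _ _
  have hmaxpos : (0 : ℝ) < max 1 ((M : ℝ) ^ 4) := one_pos.trans_le hmax
  have hS₁pos : 0 < S₁ := div_pos hε₀r hmaxpos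
  have hS₁ε : S₁ ≤ ε₀ := div_le_self (NNReal.coe_nonneg ε₀) hmax
  have hS₁M : S₁ * (M : ℝ) ^ 4 ≤ ε₀ := by
    have h1 : S₁ * (M : ℝ) ^ 4 = (ε₀ : ℝ) * ((M : ℝ) ^ 4 / max 1 ((M : ℝ) ^ 4)) := by
      rw [hS₁]; ring
    rw [h1]
    calc (ε₀ : ℝ) * ((M : ℝ) ^ 4 / max 1 ((M : ℝ) ^ 4)) ≤ (ε₀ : ℝ) * 1 :=
          mul_le_mul_of_nonneg_left (div_le_one_of_le₀ (le_max_right _ _) hmaxpos.le)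
            (NNReal.coe_nonneg ε₀)
      _ = ε₀ := mul_one _
  refine ⟨S₁, hS₁pos, g, hg, fun T u₀ u p hu₀ _hdiv hM h1 x₀ => ?_⟩
  -- ### the trivial case `T ≤ 0`
  rcases le_or_gt T 0 with hT0 | hT
  · filter_upwards [ae_restrict_mem measurableSet_Ioo] with t ht
    exact absurd (ht.1.trans_le ((le_of_lt ht.2).trans ((min_le_left _ _).trans hT0)))
      (lt_irrefl 0)
  -- ### the short strip `(0, T')`, `T' = min T S₁`
  set T' : ℝ := min T S₁ with hT'
  have hT'pos : 0 < T' := lt_min hT hS₁pos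
  have hT'T : T' ≤ T := min_le_left _ _
  have hT'S : T' ≤ S₁ := min_le_right _ _
  have hT'ε : T' ≤ (ε₀ : ℝ) := hT'S.trans hS₁ε
  have hT'1 : T' ≤ 1 := hT'ε.trans hε₀1r
  have h1' : IsLocalLeraySolutionOn T' 1 u₀ u p := h1.mono hT'T
  -- ### the datum: `∫_{B(y,1)} |u₀|² ≤ 2 M² = 2α`
  have hαM : (eLpNorm u₀ 3 volume).toNNReal ≤ M := by
    rw [← ENNReal.coe_le_coe, ENNReal.coe_toNNReal hu₀.eLpNorm_ne_top]
    exact hM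
  have hdat : ∀ y : EuclideanSpace ℝ (Fin 3), ∫⁻ x in ball y 1, ‖u₀ x‖ₑ ^ 2 ≤ 2 * (α : ℝ≥0∞) := by
    intro y
    refine (lintegral_ball_enorm_sq_le_two_mul hu₀ y zero_le_one).trans ?_
    rw [hα]
    push_cast
    rw [Real.toNNReal_one, ENNReal.coe_one, mul_one]
    gcongr
  have hT'α : T' * (α : ℝ) ^ 2 ≤ (ε₀ : ℝ) := by
    have e : (α : ℝ) ^ 2 = (M : ℝ) ^ 4 := by
      rw [hα]; push_cast; ring
    rw [e]
    calc T' * (M : ℝ) ^ 4 ≤ S₁ * (M : ℝ) ^ 4 :=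
          mul_le_mul_of_nonneg_right hT'S (by positivity)
      _ ≤ ε₀ := hS₁M
  -- ### Jia–Šverák's a priori estimate on the strip, for the structure gradient
  obtain ⟨G₀, hG₀, -⟩ := h1'.uniformLocalGradient
  obtain ⟨hEae, hD₀, -⟩ := hapr u₀ u p G₀ α T' T' hu₀.1 h1' hG₀ hdat hT'pos le_rfl hT'ε hT'α
  -- ### (E) energies on `B(x₀, 3)`, a.e. in time
  have hE3 : ∀ᵐ t ∂(volume.restrict (Ioo 0 T')), ∫⁻ x in ball x₀ 3, ‖u t x‖ₑ ^ 2 ≤ EM := by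
    filter_upwards [hEae] with t ht
    refine (hN₁ (fun x => ‖u t x‖ₑ ^ 2) _ ht x₀).trans (le_of_eq ?_)
    rw [hEM]
    push_cast
    ring
  -- ### (A) dissipation on `(0,T') × B(x₀, 3)`, for every weak gradient
  have hA3 : ∀ G : ℝ → EuclideanSpace ℝ (Fin 3) → EuclideanSpace ℝ (Fin 3) →L[ℝ] EuclideanSpace ℝ (Fin 3),
      HasWeakSpatialGradientOn (slab (EuclideanSpace ℝ (Fin 3)) (Ioo 0 T') isOpen_Ioo) u G →
      ∫⁻ z in Ioo (0 : ℝ) T' ×ˢ ball x₀ 3, ENNReal.ofReal (frobeniusNormSq (G z.1 z.2)) ≤ AM := by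
    intro G hG
    obtain ⟨-, hD, -⟩ := hapr u₀ u p G α T' T' hu₀.1 h1' hG hdat hT'pos le_rfl hT'ε hT'α
    refine (hN₂ (fun z => ENNReal.ofReal (frobeniusNormSq (G z.1 z.2))) (Ioo 0 T') _ hD x₀).trans
      (le_of_eq ?_)
    rw [hAM]
    push_cast
    ring
  -- ### (Π) Kang–Miura–Tsai's gauge about `x₀` and the renormalised pressure on the window
  obtain ⟨c, hcm, hcL, hdec, hfin⟩ := h1'.exists_measurable_gauge x₀
  have h2 : IsLocalLeraySolutionOn T' 1 u₀ u (fun t x => p t x - c t) := h1'.sub_pressure hcm hcL hfin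
  have hCα : ((C * α : ℝ≥0) : ℝ≥0∞) ≤ 2 * ((C * α : ℝ≥0) : ℝ≥0∞) := by
    rw [two_mul]; exact le_self_add
  have hPMe : ((PM : ℝ≥0) : ℝ≥0∞) =
      (P₀ : ℝ≥0∞) * ((2 : ℝ≥0∞) * ((C * α : ℝ≥0) : ℝ≥0∞)) ^ (3 / 2 : ℝ) := by
    rw [hPM, ENNReal.coe_mul, ENNReal.coe_rpow_of_nonneg _ (by norm_num : (0 : ℝ) ≤ 3 / 2),
      ENNReal.coe_mul, ENNReal.coe_ofNat]
  have hMtop : (2 : ℝ≥0∞) * ((C * α : ℝ≥0) : ℝ≥0∞) ≠ ⊤ :=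
    ENNReal.mul_ne_top ENNReal.ofNat_ne_top ENNReal.coe_ne_top
  have hPi : ∫⁻ z in Ioo (0 : ℝ) T' ×ˢ ball x₀ 3, ‖p z.1 z.2 - c z.1‖ₑ ^ (3 / 2 : ℝ) ≤ PM := by
    have h := hP₀ h1'.aestronglyMeasurable h1'.aestronglyMeasurable_pressure
      (fun y ρ => h1'.lintegral_cube_box_lt_top y ρ) hG₀ le_rfl hT'pos.le le_rfl
      (by linarith : T' - 0 ≤ 1) x₀ hcm.aestronglyMeasurable hdec hMtop le_rfl hCα hEae hD₀
    refine h.trans ?_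
    have hone : ENNReal.ofReal (T' - 0) ^ (1 / 4 : ℝ) ≤ 1 :=
      ENNReal.rpow_le_one (ENNReal.ofReal_le_one.2 (by linarith)) (by norm_num)
    calc (P₀ : ℝ≥0∞) * ((2 : ℝ≥0∞) * ((C * α : ℝ≥0) : ℝ≥0∞)) ^ (3 / 2 : ℝ) *
          ENNReal.ofReal (T' - 0) ^ (1 / 4 : ℝ)
        ≤ (P₀ : ℝ≥0∞) * ((2 : ℝ≥0∞) * ((C * α : ℝ≥0) : ℝ≥0∞)) ^ (3 / 2 : ℝ) * 1 :=
          mul_le_mul' le_rfl hone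
      _ = PM := by rw [mul_one, hPMe]
  -- ### the layer on the short strip (it does not see the gauge)
  exact hlayer T' u₀ u (fun t x => p t x - c t) x₀ hT'pos hT'1 hu₀ hM h2 hE3 hA3 hPi

end Literature.Analysis.FluidPDE

end
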